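import Summits.QuantumFields.YangMills.Theorems.BalabanUVNodesN15CovariantLandauOnePropagatorKnitSmall
import Summits.QuantumFields.YangMills.Theorems.BalabanUVNodesN15CovariantLandauNodeFourEntries
import Summits.QuantumFields.YangMills.Theorems.BalabanUVNodesN15TwoSpacingGluingCurvedKnitCovariantLandauGlobalRowsFromGradDiff
import HarnessLib

/-!
# N15 = NE2 — dag-n15-a g33, PROGRAMME (P-R)₄ «ALL FOUR ENTRIES OF (3.42) FOR THE (P-R) FAMILY», (R8b): ★★★★ THE ROAD-(c) LITERAL WITH dag-n15-c's (P-R) PROPAGATOR `X_r` IN ALL THREE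
# LAYERS AND ALL FOUR OPERATOR ENTRIES CONCRETE — `hE` DROPPED: `Live ∧ N15At` for `sfObjects₈qvr` (= F6's `sfObjects₇qvr` with `E := sfqrE₄`), modulo ONLY the Landau letter's three
# thresholded global rows (207b's `hG`), resp. n15-c∕223's display (ONE covariant gradient-difference row per grid + the two-grid defect row — ALL FOUR FLAT ROWS PROVED); pinned
# thresholds, keyed faces
# (dag-n15-a g33, (R8b); node N15 = NE2; `--supports stmt-QuantumFields-27366 --as helper`, count-neutral; 3 plumbing defs + theorems; imports (♭-3), (R8a), (♭-6))

WHY.  g32's located gap (F6 §HONEST: «TWO displayed families remain: `hE` — the rows of the (P-R) family's entries 1–3, NOT constructed in the tree — and `hG`») is closed on the `hE` side by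
PROGRAMME (P-R)₄ ((R1)–(R8a), this generation): the covariant forward-gradient entries and the `(ΔG)`-entry of (3.42) for the propagator carrying Bałaban's WHOLE covariant summand
`a·Q*(U)Q(U) − D_U(I − R(U))D*_U` are η-defect THEOREMS (R5)(R6), knitted into 207b's node by (R7a)(R7b) and made concrete by (R8a) `sfqrE₄` ∕ `ne2PlusOperator_sfqr₄E`.  THIS FILE is the
all-layers edition: (♭-3)'s §3 text with the operator certificate `ne2PlusOperator_sfqr_of_global_small … E hE hG` replaced by `ne2PlusOperator_sfqr₄E … μ₁ μ₂ hG` — the SAME site ∕ unit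
layers ((♭-2)∕(♭-3), the SAME propagator `X_r` inside the sandwiches), the SAME genuine Dirichlet region.

WHAT.  def `sfObjects₈qvr hL μ₁ μ₂ … c35 p w := sfObjects₇qvr … (sfqrE₄ … μ₁ μ₂) …`; ★★★★ `exists_live_and_n15At_sfObjects₈qvr … μ₁ μ₂ (hG) … : ∃ w, Live ∧ N15At`; def `wQ8`; ★★★★
`live_and_n15At_sfObjects₈qvr_wQ8`; keyed face `s_N15_of_admits_sf₈qvr`; and on n15-c∕223's display: ★★★★ `exists_live_and_n15At_sfObjects₈qvr_of_gradDiffRow … μ₁ μ₂ (hP) (hD)`, def `wQ8P`,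
`live_and_n15At_sfObjects₈qvr_wQ8P`, `s_N15_of_admits_sf₈qvr_gradDiff`.

HONEST FRAMING ∕ LIMITS.  Displayed remain ONLY the Landau letter's rows: `hG` (207b's three thresholded global rows), resp. `hP` (per grid the ONE covariant gradient-difference row
`D_TG′(T) − ∂G′(1)`, [B9] Thm 3.4's Schauder-type row — n15-c's located g24 object) and `hD` (the two-grid η-defect row of `N_V^R`) — HYPOTHESES; behind (♭-6) the four flat rows are King's
`A = 0` MODEL theorems (n15-c∕220) and the T⁴ cell's Combes–Thomas theorem (n15-c∕222b).  MODEL carriers ∕ operators (doubled torus `2L^{m+1}`, `L ≥ 7`, global small-field gauge, one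
averaging level, unit weights, site transporters, `Q(U)` = main term (125) of [B7] (124), King-block-mean pairing, `Reg336` idle, covariant forward gradients in FILE 144's model sense,
crude constants, `Classical.choose` thresholds); the η-rate inequalities are quantifier TEMPLATES — NOT [B9] Thms 3.1 ∕ 3.2 ∕ 3.4 ∕ 3.14 ∕ 3.15 AS PRINTED; NE2⁺ NOT PRINTED.  N15 stays DISCHARGED
OF RECORD 8∕27 AS CONSUMED (U-blind v7 pin, p687738) — no re-pin asked, nothing re-claimed, no count moved; K3⁸ OPEN; finite 𝕋⁴ per index — NOT ℝ⁴ ∕ OS ∕ mass gap ∕ Clay.  Plumbing `def`s ⇒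
review ∕ audit lane.  No `sorry`, `instance`, `notation`; standard axioms.
-/

noncomputable section

open scoped BigOperators Matrix

namespace Summit.QuantumFields.YangMills.BalabanUVNodes.N15.SiteLayerSf

open Literature.MathematicalPhysics.QuantumFieldTheory.Balaban1983to89
open Literature.MathematicalPhysics.QuantumFieldTheory.Balaban1983to89.T4EtaRate (NE2PlusOperator NE2PlusSite NE2PlusUnit rateFactor)
open Literature.MathematicalPhysics.QuantumFieldTheory.Balaban1983to89.B11SectG (BlockNorm HasMaj)
open Literature.MathematicalPhysics.QuantumFieldTheory.Balaban1983to89.B5Prop11Plancherel (Tor fine)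
open Literature.MathematicalPhysics.QuantumFieldTheory.Balaban1983to89.B6UnitTorusCarrier (unitTorusGeo)
open Literature.MathematicalPhysics.QuantumFieldTheory.Balaban1983to89.T4EtaRateDefect (idef)
open Literature.MathematicalPhysics.QuantumFieldTheory.Balaban1983to89.T4EtaRateCoeffDefect (pull)
open Literature.MathematicalPhysics.QuantumFieldTheory.King1986.Torus (blockOf)
open Literature.Barriers.QuantumFields (traceForm)
open Summit.QuantumFields.YangMills.BalabanUVNodes.N15.BackgroundLayer (gavgM)
open Summit.QuantumFields.YangMills.BalabanUVNodes.N15.VectorPiece (bshiftEquiv kingPrV tensorId)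
open Summit.QuantumFields.YangMills.BalabanUVNodes.N15.MatrixSpecies (liftBlk liftMap)
open Summit.QuantumFields.YangMills.BalabanUVNodes.N15.TwoGrid (gOp)
open Summit.QuantumFields.YangMills.BalabanUVNodes.N15.Gluing (SfIdx sfGeo sfInstance sfFamily sfqrFamily sfqrEntry0 CvX CvX' cvM cvBlk CvNorm cvNL cvNL' cvGlued cvGlued' cvNVq cvNVq' cvNVr cvNVr'
  ne2PlusOperator_sfqr_of_global_small sfqrE₄ ne2PlusOperator_sfqr₄E landauRows_small_of_gradDiffRow cvT₀)
open Summit.QuantumFields.YangMills.BalabanUVNodes.N15.OperatorReadout (opGeo)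
open Summit.QuantumFields.YangMills.BalabanUVNodes.N15.CovLandau (cgrad cGreen)
open Literature.MathematicalPhysics.QuantumFieldTheory.King1986 (aK)
open Summit.QuantumFields.YangMills.BalabanUVNodes.N15.PairedFamilyGuard (Live)
open Literature.MathematicalPhysics.QuantumFieldTheory.Balaban1983to89.T4Continuum (T4Family ULoop)
open Node00 (NE2Objects₁₁)
open Summit.QuantumFields.YangMills.BalabanUVNodes.N15.AtKeyedHome (s_N15_of_admits)
open YMDAG.UVSplit (Datum RateCarriers RateRecordPred N15At S_N15 ne2OfRecord₁₁)

variable (d : ℕ) {L : ℕ} [NeZero L] (mm ι : Type) [Fintype mm] [DecidableEq mm] [Fintype ι] [DecidableEq ι] (a : ℝ) (e : Matrix mm mm ℂ ≃L[ℝ] (ι → ℝ))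

open scoped Matrix.Norms.L2Operator

/-! ## §1 The all-layers literal with ALL FOUR operator entries concrete, on the thresholded socket; §2 on n15-c∕223's display -/

section Closed

variable [Nonempty mm]

/-- **THE ROAD-(c) LITERAL WITH THE (P-R) PROPAGATOR IN ALL THREE LAYERS AND ALL FOUR OPERATOR ENTRIES CONCRETE** at a size threshold `w`: F6's `sfObjects₇qvr` with `E := sfqrE₄ … μ₁ μ₂`
((R8a): slot 0 `sfqrEntry0`, slots 1–2 the covariant forward-gradient defects at `μ₁, μ₂`, slot 3 the `(ΔG)`-defect) — NO parameter family on the operator layer. [bookkeeping] -/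
def sfObjects₈qvr (hL : Odd L ∧ 1 < L) (μ₁ μ₂ : Fin (d + 1)) (α β : Fin (d + 1)) (j j' : ι) (α' β' : Fin (d + 1)) (j₂ j₂' : ι) (c35 p w : ℝ) : NE2Objects₁₁ :=
  sfObjects₇qvr d mm ι a e hL (sfqrE₄ d mm ι e hL a μ₁ μ₂) α β j j' α' β' j₂ j₂' c35 p w

/-- ★★★ **GUARD ∧ `N15At` AT THE (P-R) ONE-PROPAGATOR LITERAL, SOME THRESHOLD, ALL FOUR OPERATOR ENTRIES CONCRETE, GIVEN ONLY n15-c∕207b's THREE *THRESHOLDED* GLOBAL LANDAU ROWS `hG`** (`d ≥ 1`, odd `L ≥ 7`,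
`a, c₃₅ > 0`, trace-form coordinates `e`, `ι`, `mm` nonempty): OPERATOR = (R8a) `ne2PlusOperator_sfqr₄E` (ALL FOUR ENTRIES of (3.42) constructed; `hG` displayed as in 207b), SITE = §2 `ne2PlusSite_foSiteAny_sfqr_small` (`hG`),
UNIT = §2 `ne2PlusUnit_foCovAnyLam_sfqr_small` (`hG`), GUARD = (Ð-5) `live_sfGELam` — ONE propagator `X_r` in (3.42), (3.48) and (3.187), ONE displayed Landau family feeding all three layers.
[cite: Balaban1985BackgroundPropagators, Thm 3.1 (3.42) p.397, Thm 3.2 (3.47)–(3.48) p.398, Thm 3.15 (3.187) p.432 (templates: MODEL level), (3.25)–(3.26) p.395, (3.49) p.398; Balaban1985Averaging, (124)–(125) p.36] -/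
theorem exists_live_and_n15At_sfObjects₈qvr [Nonempty ι] (hd : 1 ≤ d) (hL : Odd L ∧ 1 < L) (hL7 : 7 ≤ L) (ha : 0 < a) {c35 : ℝ} (hc35 : 0 < c35)
    (he : ∀ A B : Matrix mm mm ℂ, traceForm A B = e A ⬝ᵥ e B) (μ₁ μ₂ : Fin (d + 1))
    (hG : ∃ δR cR CR γR aG : ℝ, 0 < δR ∧ 0 ≤ cR ∧ 0 ≤ CR ∧ 0 < γR ∧ 0 < aG ∧
      ∀ i : SfIdx d L, ∀ α₀ : ℝ, 0 < α₀ → (L : ℝ) ^ i.m * α₀ ≤ aG → ∀ A' : Fin (d + 1) → CvX' d L i.m i.kk i.r hL → Matrix mm mm ℂ, (sfInstance d mm ι hL i).Bf.Reg335 c35 α₀ A' →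
        HasMaj (CvNorm d L i.m i.kk hL ι) (CvNorm d L i.m i.kk hL ι) (cvNVr d L i.m i.kk hL a ι e (fun μ x => NormedSpace.exp (((((L ^ i.kk : ℕ) : ℝ))⁻¹) • gavgM (Matrix mm mm ℂ) (Fin (d + 1)) (kingPrV L i.kk i.r (cvM d L i.m i.kk hL)) A' μ x))) (fun y y' => (cR * (c35 * (L : ℝ) ^ i.m * α₀)) * Real.exp (-(δR * (unitTorusGeo L i.kk (cvM d L i.m i.kk hL)).dist y y'))) ∧
        HasMaj (BlockNorm.ofBlocks (unitTorusGeo L i.kk (cvM d L i.m i.kk hL)) (liftBlk (cvBlk d L i.m i.kk hL ∘ (kingPrV L i.kk i.r (cvM d L i.m i.kk hL))) ι)) (BlockNorm.ofBlocks (unitTorusGeo L i.kk (cvM d L i.m i.kk hL)) (liftBlk (cvBlk d L i.m i.kk hL ∘ (kingPrV L i.kk i.r (cvM d L i.m i.kk hL))) ι)) (cvNVr' d L i.m i.kk i.r hL a ι e (fun μ x' => NormedSpace.exp (((((L ^ i.r * L ^ i.kk : ℕ) : ℝ))⁻¹) • A' μ x'))) (fun y y' => (cR * (c35 * (L : ℝ)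 ^ i.m * α₀)) * Real.exp (-(δR * (unitTorusGeo L i.kk (cvM d L i.m i.kk hL)).dist y y'))) ∧
        HasMaj (CvNorm d L i.m i.kk hL ι) (BlockNorm.ofBlocks (unitTorusGeo L i.kk (cvM d L i.m i.kk hL)) (liftBlk (cvBlk d L i.m i.kk hL ∘ (kingPrV L i.kk i.r (cvM d L i.m i.kk hL))) ι)) (idef (pull (liftMap (kingPrV L i.kk i.r (cvM d L i.m i.kk hL)) ι)) (pull (liftMap (kingPrV L i.kk i.r (cvM d L i.m i.kk hL)) ι)) (cvNVr' d L i.m i.kk i.r hL a ι e (fun μ x' => NormedSpace.exp (((((L ^ i.r * L ^ i.kk : ℕ) : ℝ))⁻¹) • A' μ x'))) (cvNVr d L i.m i.kk hL a ι e (fun μ x => NormedSpace.exp (((((L ^ i.kk : ℕ) : ℝ))⁻¹) • gavgM (Matrix mm mm ℂ) (Fin (d + 1)) (kingPrV L i.kk i.r (cvM d L i.m i.kk hL)) A' μ x)))) (fun y y' => (CR * ((L : ℝ) ^ i.kk) ^ (-γR)) * Real.exp (-(δR * (unitTorusGeo L i.kk (cvM d L i.m i.kk hL)).dist y y'))))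
    (α β : Fin (d + 1)) (j j' : ι) (α' β' : Fin (d + 1)) (j₂ j₂' : ι) (p : ℝ) :
    ∃ w : ℝ, Live (ne2OfRecord₁₁ (sfObjects₈qvr d mm ι a e hL μ₁ μ₂ α β j j' α' β' j₂ j₂' c35 p w)) ∧
      N15At (ne2OfRecord₁₁ (sfObjects₈qvr d mm ι a e hL μ₁ μ₂ α β j j' α' β' j₂ j₂' c35 p w)) := by
  unfold sfObjects₈qvr
  obtain ⟨δR, cR, CR, γR, aG, hδR, hcR, hCR, hγR, haG, hG'⟩ := hG
  obtain ⟨w, hunit⟩ := ne2PlusUnit_foCovAnyLam_sfqr_small d mm ι a e hd hL hL7 ha hc35 he hδR hcR hCR hγR haG hG' α' β' j₂ j₂'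
  exact ⟨w, live_sfGELam d mm ι hL w hc35.le p _ _ _,
    ⟨ne2PlusOperator_comp (fun x : SfIdxGE d L w × RegIdx0 d => x.1.1) (ne2PlusOperator_sfqr₄E d mm ι e hL hL7 ha hc35 he μ₁ μ₂ ⟨δR, cR, CR, γR, aG, hδR, hcR, hCR, hγR, haG, hG'⟩),
      ne2PlusSite_comp (fun x : SfIdxGE d L w × RegIdx0 d => x.1.1) (ne2PlusSite_foSiteAny_sfqr_small d mm ι a e hL hL7 ha hc35 he hδR hcR hCR hγR haG hG' α β j j' 4 p),
      ne2PlusUnit_comp (fun x : SfIdxGE d L w × RegIdx0 d => ((x.1, x.2.1) : SfIdxGE d L w × Finset (Fin (d + 1) → ℤ))) hunit⟩⟩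

/-- **THE PINNED THRESHOLD** `w_Q8` of the (P-R) four-entries literal on the thresholded socket (a `Classical.choose`; the cube floor is NOT explicit). [bookkeeping] -/
def wQ8 [Nonempty ι] (hd : 1 ≤ d) (hL : Odd L ∧ 1 < L) (hL7 : 7 ≤ L) (ha : 0 < a) {c35 : ℝ} (hc35 : 0 < c35) (he : ∀ A B : Matrix mm mm ℂ, traceForm A B = e A ⬝ᵥ e B)
    (μ₁ μ₂ : Fin (d + 1))
    (hG : ∃ δR cR CR γR aG : ℝ, 0 < δR ∧ 0 ≤ cR ∧ 0 ≤ CR ∧ 0 < γR ∧ 0 < aG ∧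
      ∀ i : SfIdx d L, ∀ α₀ : ℝ, 0 < α₀ → (L : ℝ) ^ i.m * α₀ ≤ aG → ∀ A' : Fin (d + 1) → CvX' d L i.m i.kk i.r hL → Matrix mm mm ℂ, (sfInstance d mm ι hL i).Bf.Reg335 c35 α₀ A' →
        HasMaj (CvNorm d L i.m i.kk hL ι) (CvNorm d L i.m i.kk hL ι) (cvNVr d L i.m i.kk hL a ι e (fun μ x => NormedSpace.exp (((((L ^ i.kk : ℕ) : ℝ))⁻¹) • gavgM (Matrix mm mm ℂ) (Fin (d + 1)) (kingPrV L i.kk i.r (cvM d L i.m i.kk hL)) A' μ x))) (fun y y' => (cR * (c35 * (L : ℝ) ^ i.m * α₀)) * Real.exp (-(δR * (unitTorusGeo L i.kk (cvM d L i.m i.kk hL)).dist y y'))) ∧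
        HasMaj (BlockNorm.ofBlocks (unitTorusGeo L i.kk (cvM d L i.m i.kk hL)) (liftBlk (cvBlk d L i.m i.kk hL ∘ (kingPrV L i.kk i.r (cvM d L i.m i.kk hL))) ι)) (BlockNorm.ofBlocks (unitTorusGeo L i.kk (cvM d L i.m i.kk hL)) (liftBlk (cvBlk d L i.m i.kk hL ∘ (kingPrV L i.kk i.r (cvM d L i.m i.kk hL))) ι)) (cvNVr' d L i.m i.kk i.r hL a ι e (fun μ x' => NormedSpace.exp (((((L ^ i.r * L ^ i.kk : ℕ) : ℝ))⁻¹) • A' μ x'))) (fun y y' => (cR * (c35 * (L : ℝ) ^ i.m * α₀)) * Real.exp (-(δR * (unitTorusGeo L i.kk (cvM d L i.m i.kk hL)).dist y y'))) ∧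
        HasMaj (CvNorm d L i.m i.kk hL ι) (BlockNorm.ofBlocks (unitTorusGeo L i.kk (cvM d L i.m i.kk hL)) (liftBlk (cvBlk d L i.m i.kk hL ∘ (kingPrV L i.kk i.r (cvM d L i.m i.kk hL))) ι)) (idef (pull (liftMap (kingPrV L i.kk i.r (cvM d L i.m i.kk hL)) ι)) (pull (liftMap (kingPrV L i.kk i.r (cvM d L i.m i.kk hL)) ι)) (cvNVr' d L i.m i.kk i.r hL a ι e (fun μ x' => NormedSpace.exp (((((L ^ i.r * L ^ i.kk : ℕ) : ℝ))⁻¹) • A' μ x'))) (cvNVr d L i.m i.kk hL a ι e (fun μ x => NormedSpace.exp (((((L ^ i.kk : ℕ) : ℝ))⁻¹) • gavgM (Matrix mm mm ℂ) (Fin (d + 1)) (kingPrV L i.kk i.r (cvM d L i.m i.kk hL)) A' μ x)))) (fun y y' => (CR * ((L : ℝ) ^ i.kk) ^ (-γR)) * Real.exp (-(δR * (unitTorusGeo L i.kk (cvM d L i.m i.kk hL)).dist y y'))))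
    (α β : Fin (d + 1)) (j j' : ι) (α' β' : Fin (d + 1)) (j₂ j₂' : ι) (p : ℝ) : ℝ :=
  Classical.choose (exists_live_and_n15At_sfObjects₈qvr d mm ι a e hd hL hL7 ha hc35 he μ₁ μ₂ hG α β j j' α' β' j₂ j₂' p)

/-- ★★★ **GUARD ∧ `N15At` AT THE (P-R) ONE-PROPAGATOR LITERAL PINNED AT `w_Q8`** (thresholded socket, all four operator entries concrete) — the lane's most print-faithful `Live ∧ N15At`: ONE model propagator `G(U) = X_r` with Bałaban's WHOLE
covariant summand `a·Q*(U)Q(U) − D_U(I − R(U))D*_U` live, read by (3.42), (3.48) and (3.187) alike, covariant averaging in the sandwich, genuine Dirichlet region — all four operator entries CONCRETE, MODULO ONLY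
n15-c∕207b's three THRESHOLDED global Landau rows `hG`; MODEL carriers. [cite: Balaban1985BackgroundPropagators, (3.42) p.397, Thms 3.1∕3.2 p.398, Thm 3.15 p.432, (3.25)–(3.26) p.395 (shape)] -/
theorem live_and_n15At_sfObjects₈qvr_wQ8 [Nonempty ι] (hd : 1 ≤ d) (hL : Odd L ∧ 1 < L) (hL7 : 7 ≤ L) (ha : 0 < a) {c35 : ℝ} (hc35 : 0 < c35)
    (he : ∀ A B : Matrix mm mm ℂ, traceForm A B = e A ⬝ᵥ e B) (μ₁ μ₂ : Fin (d + 1))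
    (hG : ∃ δR cR CR γR aG : ℝ, 0 < δR ∧ 0 ≤ cR ∧ 0 ≤ CR ∧ 0 < γR ∧ 0 < aG ∧
      ∀ i : SfIdx d L, ∀ α₀ : ℝ, 0 < α₀ → (L : ℝ) ^ i.m * α₀ ≤ aG → ∀ A' : Fin (d + 1) → CvX' d L i.m i.kk i.r hL → Matrix mm mm ℂ, (sfInstance d mm ι hL i).Bf.Reg335 c35 α₀ A' →
        HasMaj (CvNorm d L i.m i.kk hL ι) (CvNorm d L i.m i.kk hL ι) (cvNVr d L i.m i.kk hL a ι e (fun μ x => NormedSpace.exp (((((L ^ i.kk : ℕ) : ℝ))⁻¹) • gavgM (Matrix mm mm ℂ) (Fin (d + 1)) (kingPrV L i.kk i.r (cvM d L i.m i.kk hL)) A' μ x))) (fun y y' => (cR * (c35 * (L : ℝ) ^ i.m * α₀)) * Real.exp (-(δR * (unitTorusGeo L i.kk (cvM d L i.m i.kk hL)).dist y y'))) ∧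
        HasMaj (BlockNorm.ofBlocks (unitTorusGeo L i.kk (cvM d L i.m i.kk hL)) (liftBlk (cvBlk d L i.m i.kk hL ∘ (kingPrV L i.kk i.r (cvM d L i.m i.kk hL))) ι)) (BlockNorm.ofBlocks (unitTorusGeo L i.kk (cvM d L i.m i.kk hL)) (liftBlk (cvBlk d L i.m i.kk hL ∘ (kingPrV L i.kk i.r (cvM d L i.m i.kk hL))) ι)) (cvNVr' d L i.m i.kk i.r hL a ι e (fun μ x' => NormedSpace.exp (((((L ^ i.r * L ^ i.kk : ℕ) : ℝ))⁻¹) • A' μ x'))) (fun y y' => (cR * (c35 * (L : ℝ) ^ i.m * α₀)) * Real.exp (-(δR * (unitTorusGeo L i.kk (cvM d L i.m i.kk hL)).dist y y'))) ∧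
        HasMaj (CvNorm d L i.m i.kk hL ι) (BlockNorm.ofBlocks (unitTorusGeo L i.kk (cvM d L i.m i.kk hL)) (liftBlk (cvBlk d L i.m i.kk hL ∘ (kingPrV L i.kk i.r (cvM d L i.m i.kk hL))) ι)) (idef (pull (liftMap (kingPrV L i.kk i.r (cvM d L i.m i.kk hL)) ι)) (pull (liftMap (kingPrV L i.kk i.r (cvM d L i.m i.kk hL)) ι)) (cvNVr' d L i.m i.kk i.r hL a ι e (fun μ x' => NormedSpace.exp (((((L ^ i.r * L ^ i.kk : ℕ) : ℝ))⁻¹) • A' μ x'))) (cvNVr d L i.m i.kk hL a ι e (fun μ x => NormedSpace.exp (((((L ^ i.kk : ℕ) : ℝ))⁻¹) • gavgM (Matrix mm mm ℂ) (Fin (d + 1)) (kingPrV L i.kk i.r (cvM d L i.m i.kk hL)) A' μ x)))) (fun y y' => (CR * ((L : ℝ) ^ i.kk) ^ (-γR)) * Real.exp (-(δR * (unitTorusGeo L i.kk (cvM d L i.m i.kk hL)).dist y y'))))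
    (α β : Fin (d + 1)) (j j' : ι) (α' β' : Fin (d + 1)) (j₂ j₂' : ι) (p : ℝ) :
    Live (ne2OfRecord₁₁ (sfObjects₈qvr d mm ι a e hL μ₁ μ₂ α β j j' α' β' j₂ j₂' c35 p (wQ8 d mm ι a e hd hL hL7 ha hc35 he μ₁ μ₂ hG α β j j' α' β' j₂ j₂' p))) ∧
      N15At (ne2OfRecord₁₁ (sfObjects₈qvr d mm ι a e hL μ₁ μ₂ α β j j' α' β' j₂ j₂' c35 p (wQ8 d mm ι a e hd hL hL7 ha hc35 he μ₁ μ₂ hG α β j j' α' β' j₂ j₂' p))) :=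
  Classical.choose_spec (exists_live_and_n15At_sfObjects₈qvr d mm ι a e hd hL hL7 ha hc35 he μ₁ μ₂ hG α β j j' α' β' j₂ j₂' p)

variable {N : ℕ} [NeZero N] {key : (F : T4Family) → Datum F N → Prop}

/-- ★★ **THE (P-R) FOUR-ENTRIES LITERAL AT ANY KEYED HOME** (part 30's interface; `ne2At` a BINDER, `hadm` AND the value equation `h` hypotheses — no pin, no v8): a rate home over ANY key
admitting only the literals of a key-indexed NE2 reading whose value everywhere is the pinned (P-R) one-propagator literal has `S_N15 RRec` — modulo `hG` (thresholded) ONLY. [bookkeeping] -/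
theorem s_N15_of_admits_sf₈qvr [Nonempty ι] (hd : 1 ≤ d) (hL : Odd L ∧ 1 < L) (hL7 : 7 ≤ L) (ha : 0 < a) {c35 : ℝ} (hc35 : 0 < c35)
    (he : ∀ A B : Matrix mm mm ℂ, traceForm A B = e A ⬝ᵥ e B) (μ₁ μ₂ : Fin (d + 1))
    (hG : ∃ δR cR CR γR aG : ℝ, 0 < δR ∧ 0 ≤ cR ∧ 0 ≤ CR ∧ 0 < γR ∧ 0 < aG ∧
      ∀ i : SfIdx d L, ∀ α₀ : ℝ, 0 < α₀ → (L : ℝ) ^ i.m * α₀ ≤ aG → ∀ A' : Fin (d + 1) → CvX' d L i.m i.kk i.r hL → Matrix mm mm ℂ, (sfInstance d mm ι hL i).Bf.Reg335 c35 α₀ A' →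
        HasMaj (CvNorm d L i.m i.kk hL ι) (CvNorm d L i.m i.kk hL ι) (cvNVr d L i.m i.kk hL a ι e (fun μ x => NormedSpace.exp (((((L ^ i.kk : ℕ) : ℝ))⁻¹) • gavgM (Matrix mm mm ℂ) (Fin (d + 1)) (kingPrV L i.kk i.r (cvM d L i.m i.kk hL)) A' μ x))) (fun y y' => (cR * (c35 * (L : ℝ) ^ i.m * α₀)) * Real.exp (-(δR * (unitTorusGeo L i.kk (cvM d L i.m i.kk hL)).dist y y'))) ∧
        HasMaj (BlockNorm.ofBlocks (unitTorusGeo L i.kk (cvM d L i.m i.kk hL)) (liftBlk (cvBlk d L i.m i.kk hL ∘ (kingPrV L i.kk i.r (cvM d L i.m i.kk hL))) ι)) (BlockNorm.ofBlocks (unitTorusGeo L i.kk (cvM d L i.m i.kk hL)) (liftBlk (cvBlk d L i.m i.kk hL ∘ (kingPrV L i.kk i.r (cvM d L i.m i.kk hL))) ι)) (cvNVr' d L i.m i.kk i.r hL a ι e (fun μ x' => NormedSpace.exp (((((L ^ i.r * L ^ i.kk : ℕ) : ℝ))⁻¹) • A' μ x'))) (fun y y' => (cR * (c35 * (L : ℝ)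 ^ i.m * α₀)) * Real.exp (-(δR * (unitTorusGeo L i.kk (cvM d L i.m i.kk hL)).dist y y'))) ∧
        HasMaj (CvNorm d L i.m i.kk hL ι) (BlockNorm.ofBlocks (unitTorusGeo L i.kk (cvM d L i.m i.kk hL)) (liftBlk (cvBlk d L i.m i.kk hL ∘ (kingPrV L i.kk i.r (cvM d L i.m i.kk hL))) ι)) (idef (pull (liftMap (kingPrV L i.kk i.r (cvM d L i.m i.kk hL)) ι)) (pull (liftMap (kingPrV L i.kk i.r (cvM d L i.m i.kk hL)) ι)) (cvNVr' d L i.m i.kk i.r hL a ι e (fun μ x' => NormedSpace.exp (((((L ^ i.r * L ^ i.kk : ℕ) : ℝ))⁻¹) • A' μ x'))) (cvNVr d L i.m i.kk hL a ι e (fun μ x => NormedSpace.exp (((((L ^ i.kk : ℕ) : ℝ))⁻¹) • gavgM (Matrix mm mm ℂ) (Fin (d + 1)) (kingPrV L i.kk i.r (cvM d L i.m i.kk hL)) A' μ x)))) (fun y y' => (CR * ((L : ℝ) ^ i.kk) ^ (-γR)) * Real.exp (-(δR * (unitTorusGeo L i.kk (cvM d L i.m i.kk hL)).dist y y'))))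
    (α β : Fin (d + 1)) (j j' : ι) (α' β' : Fin (d + 1)) (j₂ j₂' : ι) (p : ℝ)
    (ne2At : ∀ {F : T4Family} {D : Datum F N}, key F D → (ℕ → ℝ) → List (ULoop F) → ℕ → NE2Objects₁₁) (RRec : RateRecordPred N)
    (hadm : ∀ (F : T4Family) (D : Datum F N) (g₀ : ℕ → ℝ) (os : List (ULoop F)) (R : RateCarriers N), RRec F D g₀ os R →
      ∃ (h : key F D) (k : ℕ), R.ne2 = ne2OfRecord₁₁ (ne2At h g₀ os k))
    (h : ∀ (F : T4Family) (D : Datum F N) (h : key F D) (g₀ : ℕ → ℝ) (os : List (ULoop F)) (k : ℕ),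
      ne2At h g₀ os k = sfObjects₈qvr d mm ι a e hL μ₁ μ₂ α β j j' α' β' j₂ j₂' c35 p (wQ8 d mm ι a e hd hL hL7 ha hc35 he μ₁ μ₂ hG α β j j' α' β' j₂ j₂' p)) :
    S_N15 RRec :=
  s_N15_of_admits ne2At RRec hadm fun F D hk g₀ os k => by
    rw [h F D hk g₀ os k]
    exact (live_and_n15At_sfObjects₈qvr_wQ8 d mm ι a e hd hL hL7 ha hc35 he μ₁ μ₂ hG α β j j' α' β' j₂ j₂' p).2


/-! ### The same on n15-c∕223's display (ALL FOUR FLAT ROWS PROVED): `hG` ↦ `hP`, `hD` via (♭-6) -/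

/-- ★★★ **GUARD ∧ `N15At` AT THE (P-R) ONE-PROPAGATOR LITERAL, SOME THRESHOLD, ALL FOUR OPERATOR ENTRIES CONCRETE, ON n15-c∕223's DISPLAY — ALL FOUR FLAT ROWS PROVED** (`hP` = one covariant gradient-difference row per grid, `hD` = the two-grid defect row of `N_V^R`; via (♭-6)) (`d ≥ 1`, odd `L ≥ 7`,
`a, c₃₅ > 0`, trace-form coordinates `e`, `ι`, `mm` nonempty): OPERATOR = (R8a) `ne2PlusOperator_sfqr₄E` (ALL FOUR ENTRIES of (3.42) constructed; `hG` displayed as in 207b), SITE = §2 `ne2PlusSite_foSiteAny_sfqr_small` (`hG`),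
UNIT = §2 `ne2PlusUnit_foCovAnyLam_sfqr_small` (`hG`), GUARD = (Ð-5) `live_sfGELam` — ONE propagator `X_r` in (3.42), (3.48) and (3.187), ONE displayed Landau family feeding all three layers.
[cite: Balaban1985BackgroundPropagators, Thm 3.1 (3.42) p.397, Thm 3.2 (3.47)–(3.48) p.398, Thm 3.15 (3.187) p.432 (templates: MODEL level), (3.25)–(3.26) p.395, (3.49) p.398; Balaban1985Averaging, (124)–(125) p.36] -/
theorem exists_live_and_n15At_sfObjects₈qvr_of_gradDiffRow [Nonempty ι] (hd : 1 ≤ d) (hL : Odd L ∧ 1 < L) (hL7 : 7 ≤ L) (ha : 0 < a) {c35 : ℝ} (hc35 : 0 < c35)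
    (he : ∀ A B : Matrix mm mm ℂ, traceForm A B = e A ⬝ᵥ e B) (μ₁ μ₂ : Fin (d + 1))
    (hP : ∃ δ₂ P0 aP : ℝ, 0 < δ₂ ∧ 0 ≤ P0 ∧ 0 < aP ∧ ∀ i : SfIdx d L,
        ∀ α₀ : ℝ, 0 < α₀ → (L : ℝ) ^ i.m * α₀ ≤ aP → ∀ A' : Fin (d + 1) → CvX' d L i.m i.kk i.r hL → Matrix mm mm ℂ, (sfInstance d mm ι hL i).Bf.Reg335 c35 α₀ A' →
          HasMaj (BlockNorm.ofBlocks (unitTorusGeo L i.kk (cvM d L i.m i.kk hL)) (liftBlk (blockOf (L ^ i.kk) (cvM d L i.m i.kk hL)) ι)) (BlockNorm.ofBlocks (unitTorusGeo L i.kk (cvM d L i.m i.kk hL)) (liftBlk (fun b : Tor (fine (L ^ i.kk) (cvM d L i.m i.kk hL)) × Fin (d + 1) => blockOf (L ^ i.kk) (cvM d L i.m i.kk hL) b.1) ι)) (Matrix.mulVecLin (cgrad (cvM d L i.m i.kk hL) (L ^ i.kk) (cvT₀ e (fun μ x => NormedSpace.exp (((((L ^ i.kk : ℕ) : ℝ))⁻¹)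 • gavgM (Matrix mm mm ℂ) (Fin (d + 1)) (kingPrV L i.kk i.r (cvM d L i.m i.kk hL)) A' μ x))) * cGreen (cvM d L i.m i.kk hL) (L ^ i.kk) (cvT₀ e (fun μ x => NormedSpace.exp (((((L ^ i.kk : ℕ) : ℝ))⁻¹) • gavgM (Matrix mm mm ℂ) (Fin (d + 1)) (kingPrV L i.kk i.r (cvM d L i.m i.kk hL)) A' μ x))) (aK 1 (L : ℝ) i.kk * ((L ^ i.kk : ℕ) : ℝ) ^ (d + 1)) - cgrad (cvM d L i.m i.kk hL) (L ^ i.kk) (fun (_ : Fin (d + 1)) (_ : Tor (fine (L ^ i.kk) (cvM d L i.m i.kk hL))) => (1 : Matrix ι ι ℝ)) * cGreen (cvM d L i.m i.kk hL) (L ^ i.kk) (fun (_ : Fin (d + 1)) (_ : Tor (fine (L ^ i.kk) (cvM d L i.m i.kk hL))) => (1 : Matrix ι ι ℝ)) (aK 1 (L : ℝ) i.kk * ((L ^ i.kk : ℕ) : ℝ) ^ (d + 1)))) (fun y y' => P0 * (c35 * (L : ℝ) ^ i.m * α₀) * Real.exp (-(δ₂ * (unitTorusGeo L i.kk (cvM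 d L i.m i.kk hL)).dist y y'))) ∧
          HasMaj (BlockNorm.ofBlocks (unitTorusGeo L i.kk (cvM d L i.m i.kk hL)) (liftBlk (blockOf (L ^ i.r * L ^ i.kk) (cvM d L i.m i.kk hL)) ι)) (BlockNorm.ofBlocks (unitTorusGeo L i.kk (cvM d L i.m i.kk hL)) (liftBlk (fun b : Tor (fine (L ^ i.r * L ^ i.kk) (cvM d L i.m i.kk hL)) × Fin (d + 1) => blockOf (L ^ i.r * L ^ i.kk) (cvM d L i.m i.kk hL) b.1) ι)) (Matrix.mulVecLin (cgrad (cvM d L i.m i.kk hL) (L ^ i.r * L ^ i.kk) (cvT₀ e (fun μ x' => NormedSpace.exp (((((L ^ i.r * L ^ i.kk : ℕ) : ℝ))⁻¹) • A' μ x'))) * cGreen (cvM d L i.m i.kk hL) (L ^ i.r * L ^ i.kk) (cvT₀ e (fun μ x' => NormedSpace.exp (((((L ^ i.r * L ^ i.kk : ℕ) : ℝ))⁻¹) • A' μ x'))) (aK 1 (L : ℝ) (i.r + i.kk) * ((L ^ i.r * L ^ i.kk : ℕ) : ℝ) ^ (d + 1)) - cgrad (cvM d L i.m i.kk hL) (L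 ^ i.r * L ^ i.kk) (fun (_ : Fin (d + 1)) (_ : Tor (fine (L ^ i.r * L ^ i.kk) (cvM d L i.m i.kk hL))) => (1 : Matrix ι ι ℝ)) * cGreen (cvM d L i.m i.kk hL) (L ^ i.r * L ^ i.kk) (fun (_ : Fin (d + 1)) (_ : Tor (fine (L ^ i.r * L ^ i.kk) (cvM d L i.m i.kk hL))) => (1 : Matrix ι ι ℝ)) (aK 1 (L : ℝ) (i.r + i.kk) * ((L ^ i.r * L ^ i.kk : ℕ) : ℝ) ^ (d + 1)))) (fun y y' => P0 * (c35 * (L : ℝ) ^ i.m * α₀) * Real.exp (-(δ₂ * (unitTorusGeo L i.kk (cvM d L i.m i.kk hL)).dist y y'))))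
    (hD : ∃ δD CR γR aD : ℝ, 0 < δD ∧ 0 ≤ CR ∧ 0 < γR ∧ 0 < aD ∧
      ∀ i : SfIdx d L, ∀ α₀ : ℝ, 0 < α₀ → (L : ℝ) ^ i.m * α₀ ≤ aD → ∀ A' : Fin (d + 1) → CvX' d L i.m i.kk i.r hL → Matrix mm mm ℂ, (sfInstance d mm ι hL i).Bf.Reg335 c35 α₀ A' →
        HasMaj (CvNorm d L i.m i.kk hL ι) (BlockNorm.ofBlocks (unitTorusGeo L i.kk (cvM d L i.m i.kk hL)) (liftBlk (cvBlk d L i.m i.kk hL ∘ (kingPrV L i.kk i.r (cvM d L i.m i.kk hL))) ι)) (idef (pull (liftMap (kingPrV L i.kk i.r (cvM d L i.m i.kk hL)) ι)) (pull (liftMap (kingPrV L i.kk i.r (cvM d L i.m i.kk hL)) ι)) (cvNVr' d L i.m i.kk i.r hL a ι e (fun μ x' => NormedSpace.exp (((((L ^ i.r * L ^ i.kk : ℕ) : ℝ))⁻¹) • A' μ x'))) (cvNVr d L i.m i.kk hL a ι e (fun μ x => NormedSpace.exp (((((L ^ i.kk : ℕ) : ℝ))⁻¹) • gavgM (Matrix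 mm mm ℂ) (Fin (d + 1)) (kingPrV L i.kk i.r (cvM d L i.m i.kk hL)) A' μ x)))) (fun y y' => (CR * ((L : ℝ) ^ i.kk) ^ (-γR)) * Real.exp (-(δD * (unitTorusGeo L i.kk (cvM d L i.m i.kk hL)).dist y y'))))
    (α β : Fin (d + 1)) (j j' : ι) (α' β' : Fin (d + 1)) (j₂ j₂' : ι) (p : ℝ) :
    ∃ w : ℝ, Live (ne2OfRecord₁₁ (sfObjects₈qvr d mm ι a e hL μ₁ μ₂ α β j j' α' β' j₂ j₂' c35 p w)) ∧
      N15At (ne2OfRecord₁₁ (sfObjects₈qvr d mm ι a e hL μ₁ μ₂ α β j j' α' β' j₂ j₂' c35 p w)) :=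
  exists_live_and_n15At_sfObjects₈qvr d mm ι a e hd hL hL7 ha hc35 he μ₁ μ₂ (landauRows_small_of_gradDiffRow d mm ι e hL hL7 ha hc35 hP hD) α β j j' α' β' j₂ j₂' p

/-- **THE PINNED THRESHOLD** `w_Q8` of the (P-R) four-entries literal on the thresholded socket (a `Classical.choose`; the cube floor is NOT explicit). [bookkeeping] -/
def wQ8P [Nonempty ι] (hd : 1 ≤ d) (hL : Odd L ∧ 1 < L) (hL7 : 7 ≤ L) (ha : 0 < a) {c35 : ℝ} (hc35 : 0 < c35) (he : ∀ A B : Matrix mm mm ℂ, traceForm A B = e A ⬝ᵥ e B)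
    (μ₁ μ₂ : Fin (d + 1))
    (hP : ∃ δ₂ P0 aP : ℝ, 0 < δ₂ ∧ 0 ≤ P0 ∧ 0 < aP ∧ ∀ i : SfIdx d L,
        ∀ α₀ : ℝ, 0 < α₀ → (L : ℝ) ^ i.m * α₀ ≤ aP → ∀ A' : Fin (d + 1) → CvX' d L i.m i.kk i.r hL → Matrix mm mm ℂ, (sfInstance d mm ι hL i).Bf.Reg335 c35 α₀ A' →
          HasMaj (BlockNorm.ofBlocks (unitTorusGeo L i.kk (cvM d L i.m i.kk hL)) (liftBlk (blockOf (L ^ i.kk) (cvM d L i.m i.kk hL)) ι)) (BlockNorm.ofBlocks (unitTorusGeo L i.kk (cvM d L i.m i.kk hL)) (liftBlk (fun b : Tor (fine (L ^ i.kk) (cvM d L i.m i.kk hL)) × Fin (d + 1) => blockOf (L ^ i.kk) (cvM d L i.m i.kk hL) b.1) ι)) (Matrix.mulVecLin (cgrad (cvM d L i.m i.kk hL) (L ^ i.kk) (cvT₀ e (fun μ x => NormedSpace.exp (((((L ^ i.kk : ℕ) : ℝ))⁻¹) • gavgM (Matrix mm mm ℂ) (Fin (d + 1)) (kingPrV L i.kk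 i.r (cvM d L i.m i.kk hL)) A' μ x))) * cGreen (cvM d L i.m i.kk hL) (L ^ i.kk) (cvT₀ e (fun μ x => NormedSpace.exp (((((L ^ i.kk : ℕ) : ℝ))⁻¹) • gavgM (Matrix mm mm ℂ) (Fin (d + 1)) (kingPrV L i.kk i.r (cvM d L i.m i.kk hL)) A' μ x))) (aK 1 (L : ℝ) i.kk * ((L ^ i.kk : ℕ) : ℝ) ^ (d + 1)) - cgrad (cvM d L i.m i.kk hL) (L ^ i.kk) (fun (_ : Fin (d + 1)) (_ : Tor (fine (L ^ i.kk) (cvM d L i.m i.kk hL))) => (1 : Matrix ι ι ℝ)) * cGreen (cvM d L i.m i.kk hL) (L ^ i.kk) (fun (_ : Fin (d + 1)) (_ : Tor (fine (L ^ i.kk) (cvM d L i.m i.kk hL))) => (1 : Matrix ι ι ℝ)) (aK 1 (L : ℝ) i.kk * ((L ^ i.kk : ℕ) : ℝ) ^ (d + 1)))) (fun y y' => P0 * (c35 * (L : ℝ) ^ i.m * α₀) * Real.exp (-(δ₂ * (unitTorusGeo L i.kk (cvM d L i.m i.kk hL)).dist y y'))) ∧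
          HasMaj (BlockNorm.ofBlocks (unitTorusGeo L i.kk (cvM d L i.m i.kk hL)) (liftBlk (blockOf (L ^ i.r * L ^ i.kk) (cvM d L i.m i.kk hL)) ι)) (BlockNorm.ofBlocks (unitTorusGeo L i.kk (cvM d L i.m i.kk hL)) (liftBlk (fun b : Tor (fine (L ^ i.r * L ^ i.kk) (cvM d L i.m i.kk hL)) × Fin (d + 1) => blockOf (L ^ i.r * L ^ i.kk) (cvM d L i.m i.kk hL) b.1) ι)) (Matrix.mulVecLin (cgrad (cvM d L i.m i.kk hL) (L ^ i.r * L ^ i.kk) (cvT₀ e (fun μ x' => NormedSpace.exp (((((L ^ i.r * L ^ i.kk : ℕ) : ℝ))⁻¹) • A' μ x'))) * cGreen (cvM d L i.m i.kk hL) (L ^ i.r * L ^ i.kk) (cvT₀ e (fun μ x' => NormedSpace.exp (((((L ^ i.r * L ^ i.kk : ℕ) : ℝ))⁻¹) • A' μ x'))) (aK 1 (L : ℝ) (i.r + i.kk) * ((L ^ i.r * L ^ i.kk : ℕ) : ℝ) ^ (d + 1)) - cgrad (cvM d L i.m i.kk hL) (L ^ i.r * L ^ i.kk) (fun (_ : Fin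 (d + 1)) (_ : Tor (fine (L ^ i.r * L ^ i.kk) (cvM d L i.m i.kk hL))) => (1 : Matrix ι ι ℝ)) * cGreen (cvM d L i.m i.kk hL) (L ^ i.r * L ^ i.kk) (fun (_ : Fin (d + 1)) (_ : Tor (fine (L ^ i.r * L ^ i.kk) (cvM d L i.m i.kk hL))) => (1 : Matrix ι ι ℝ)) (aK 1 (L : ℝ) (i.r + i.kk) * ((L ^ i.r * L ^ i.kk : ℕ) : ℝ) ^ (d + 1)))) (fun y y' => P0 * (c35 * (L : ℝ) ^ i.m * α₀) * Real.exp (-(δ₂ * (unitTorusGeo L i.kk (cvM d L i.m i.kk hL)).dist y y'))))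
    (hD : ∃ δD CR γR aD : ℝ, 0 < δD ∧ 0 ≤ CR ∧ 0 < γR ∧ 0 < aD ∧
      ∀ i : SfIdx d L, ∀ α₀ : ℝ, 0 < α₀ → (L : ℝ) ^ i.m * α₀ ≤ aD → ∀ A' : Fin (d + 1) → CvX' d L i.m i.kk i.r hL → Matrix mm mm ℂ, (sfInstance d mm ι hL i).Bf.Reg335 c35 α₀ A' →
        HasMaj (CvNorm d L i.m i.kk hL ι) (BlockNorm.ofBlocks (unitTorusGeo L i.kk (cvM d L i.m i.kk hL)) (liftBlk (cvBlk d L i.m i.kk hL ∘ (kingPrV L i.kk i.r (cvM d L i.m i.kk hL))) ι)) (idef (pull (liftMap (kingPrV L i.kk i.r (cvM d L i.m i.kk hL)) ι)) (pull (liftMap (kingPrV L i.kk i.r (cvM d L i.m i.kk hL)) ι)) (cvNVr' d L i.m i.kk i.r hL a ι e (fun μ x' => NormedSpace.exp (((((L ^ i.r * L ^ i.kk : ℕ) : ℝ))⁻¹) • A' μ x'))) (cvNVr d L i.m i.kk hL a ι e (fun μ x => NormedSpace.exp (((((L ^ i.kk : ℕ) : ℝ))⁻¹) • gavgM (Matrix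 mm mm ℂ) (Fin (d + 1)) (kingPrV L i.kk i.r (cvM d L i.m i.kk hL)) A' μ x)))) (fun y y' => (CR * ((L : ℝ) ^ i.kk) ^ (-γR)) * Real.exp (-(δD * (unitTorusGeo L i.kk (cvM d L i.m i.kk hL)).dist y y'))))
    (α β : Fin (d + 1)) (j j' : ι) (α' β' : Fin (d + 1)) (j₂ j₂' : ι) (p : ℝ) : ℝ :=
  Classical.choose (exists_live_and_n15At_sfObjects₈qvr_of_gradDiffRow d mm ι a e hd hL hL7 ha hc35 he μ₁ μ₂ hP hD α β j j' α' β' j₂ j₂' p)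

/-- ★★★ **GUARD ∧ `N15At` AT THE (P-R) ONE-PROPAGATOR LITERAL PINNED AT `w_Q8`** (thresholded socket, all four operator entries concrete) — the lane's most print-faithful `Live ∧ N15At`: ONE model propagator `G(U) = X_r` with Bałaban's WHOLE
covariant summand `a·Q*(U)Q(U) − D_U(I − R(U))D*_U` live, read by (3.42), (3.48) and (3.187) alike, covariant averaging in the sandwich, genuine Dirichlet region — all four operator entries CONCRETE, MODULO ONLY
n15-c∕207b's three THRESHOLDED global Landau rows `hG`; MODEL carriers. [cite: Balaban1985BackgroundPropagators, (3.42) p.397, Thms 3.1∕3.2 p.398, Thm 3.15 p.432, (3.25)–(3.26) p.395 (shape)] -/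
theorem live_and_n15At_sfObjects₈qvr_wQ8P [Nonempty ι] (hd : 1 ≤ d) (hL : Odd L ∧ 1 < L) (hL7 : 7 ≤ L) (ha : 0 < a) {c35 : ℝ} (hc35 : 0 < c35)
    (he : ∀ A B : Matrix mm mm ℂ, traceForm A B = e A ⬝ᵥ e B) (μ₁ μ₂ : Fin (d + 1))
    (hP : ∃ δ₂ P0 aP : ℝ, 0 < δ₂ ∧ 0 ≤ P0 ∧ 0 < aP ∧ ∀ i : SfIdx d L,
        ∀ α₀ : ℝ, 0 < α₀ → (L : ℝ) ^ i.m * α₀ ≤ aP → ∀ A' : Fin (d + 1) → CvX' d L i.m i.kk i.r hL → Matrix mm mm ℂ, (sfInstance d mm ι hL i).Bf.Reg335 c35 α₀ A' →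
          HasMaj (BlockNorm.ofBlocks (unitTorusGeo L i.kk (cvM d L i.m i.kk hL)) (liftBlk (blockOf (L ^ i.kk) (cvM d L i.m i.kk hL)) ι)) (BlockNorm.ofBlocks (unitTorusGeo L i.kk (cvM d L i.m i.kk hL)) (liftBlk (fun b : Tor (fine (L ^ i.kk) (cvM d L i.m i.kk hL)) × Fin (d + 1) => blockOf (L ^ i.kk) (cvM d L i.m i.kk hL) b.1) ι)) (Matrix.mulVecLin (cgrad (cvM d L i.m i.kk hL) (L ^ i.kk) (cvT₀ e (fun μ x => NormedSpace.exp (((((L ^ i.kk : ℕ) : ℝ))⁻¹) • gavgM (Matrix mm mm ℂ) (Fin (d + 1)) (kingPrV L i.kk i.r (cvM d L i.m i.kk hL)) A' μ x))) * cGreen (cvM d L i.m i.kk hL) (L ^ i.kk) (cvT₀ e (fun μ x => NormedSpace.exp (((((L ^ i.kk : ℕ) : ℝ))⁻¹) • gavgM (Matrix mm mm ℂ) (Fin (d + 1)) (kingPrV L i.kk i.r (cvM d L i.m i.kk hL)) A' μ x))) (aK 1 (L : ℝ) i.kk * ((L ^ i.kk : ℕ) : ℝ) ^ (d + 1)) -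 cgrad (cvM d L i.m i.kk hL) (L ^ i.kk) (fun (_ : Fin (d + 1)) (_ : Tor (fine (L ^ i.kk) (cvM d L i.m i.kk hL))) => (1 : Matrix ι ι ℝ)) * cGreen (cvM d L i.m i.kk hL) (L ^ i.kk) (fun (_ : Fin (d + 1)) (_ : Tor (fine (L ^ i.kk) (cvM d L i.m i.kk hL))) => (1 : Matrix ι ι ℝ)) (aK 1 (L : ℝ) i.kk * ((L ^ i.kk : ℕ) : ℝ) ^ (d + 1)))) (fun y y' => P0 * (c35 * (L : ℝ) ^ i.m * α₀) * Real.exp (-(δ₂ * (unitTorusGeo L i.kk (cvM d L i.m i.kk hL)).dist y y'))) ∧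
          HasMaj (BlockNorm.ofBlocks (unitTorusGeo L i.kk (cvM d L i.m i.kk hL)) (liftBlk (blockOf (L ^ i.r * L ^ i.kk) (cvM d L i.m i.kk hL)) ι)) (BlockNorm.ofBlocks (unitTorusGeo L i.kk (cvM d L i.m i.kk hL)) (liftBlk (fun b : Tor (fine (L ^ i.r * L ^ i.kk) (cvM d L i.m i.kk hL)) × Fin (d + 1) => blockOf (L ^ i.r * L ^ i.kk) (cvM d L i.m i.kk hL) b.1) ι)) (Matrix.mulVecLin (cgrad (cvM d L i.m i.kk hL) (L ^ i.r * L ^ i.kk) (cvT₀ e (fun μ x' => NormedSpace.exp (((((L ^ i.r * L ^ i.kk : ℕ) : ℝ))⁻¹) • A' μ x'))) * cGreen (cvM d L i.m i.kk hL) (L ^ i.r * L ^ i.kk) (cvT₀ e (fun μ x' => NormedSpace.exp (((((L ^ i.r * L ^ i.kk : ℕ) : ℝ))⁻¹) • A' μ x'))) (aK 1 (L : ℝ) (i.r + i.kk) * ((L ^ i.r * L ^ i.kk : ℕ) : ℝ) ^ (d + 1)) - cgrad (cvM d L i.m i.kk hL) (L ^ i.r * L ^ i.kk) (fun (_ : Fin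 (d + 1)) (_ : Tor (fine (L ^ i.r * L ^ i.kk) (cvM d L i.m i.kk hL))) => (1 : Matrix ι ι ℝ)) * cGreen (cvM d L i.m i.kk hL) (L ^ i.r * L ^ i.kk) (fun (_ : Fin (d + 1)) (_ : Tor (fine (L ^ i.r * L ^ i.kk) (cvM d L i.m i.kk hL))) => (1 : Matrix ι ι ℝ)) (aK 1 (L : ℝ) (i.r + i.kk) * ((L ^ i.r * L ^ i.kk : ℕ) : ℝ) ^ (d + 1)))) (fun y y' => P0 * (c35 * (L : ℝ) ^ i.m * α₀) * Real.exp (-(δ₂ * (unitTorusGeo L i.kk (cvM d L i.m i.kk hL)).dist y y'))))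
    (hD : ∃ δD CR γR aD : ℝ, 0 < δD ∧ 0 ≤ CR ∧ 0 < γR ∧ 0 < aD ∧
      ∀ i : SfIdx d L, ∀ α₀ : ℝ, 0 < α₀ → (L : ℝ) ^ i.m * α₀ ≤ aD → ∀ A' : Fin (d + 1) → CvX' d L i.m i.kk i.r hL → Matrix mm mm ℂ, (sfInstance d mm ι hL i).Bf.Reg335 c35 α₀ A' →
        HasMaj (CvNorm d L i.m i.kk hL ι) (BlockNorm.ofBlocks (unitTorusGeo L i.kk (cvM d L i.m i.kk hL)) (liftBlk (cvBlk d L i.m i.kk hL ∘ (kingPrV L i.kk i.r (cvM d L i.m i.kk hL))) ι)) (idef (pull (liftMap (kingPrV L i.kk i.r (cvM d L i.m i.kk hL)) ι)) (pull (liftMap (kingPrV L i.kk i.r (cvM d L i.m i.kk hL)) ι)) (cvNVr' d L i.m i.kk i.r hL a ι e (fun μ x' => NormedSpace.exp (((((L ^ i.r * L ^ i.kk : ℕ) : ℝ))⁻¹) • A' μ x'))) (cvNVr d L i.m i.kk hL a ι e (fun μ x => NormedSpace.exp (((((L ^ i.kk : ℕ) : ℝ))⁻¹) • gavgM (Matrix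 mm mm ℂ) (Fin (d + 1)) (kingPrV L i.kk i.r (cvM d L i.m i.kk hL)) A' μ x)))) (fun y y' => (CR * ((L : ℝ) ^ i.kk) ^ (-γR)) * Real.exp (-(δD * (unitTorusGeo L i.kk (cvM d L i.m i.kk hL)).dist y y'))))
    (α β : Fin (d + 1)) (j j' : ι) (α' β' : Fin (d + 1)) (j₂ j₂' : ι) (p : ℝ) :
    Live (ne2OfRecord₁₁ (sfObjects₈qvr d mm ι a e hL μ₁ μ₂ α β j j' α' β' j₂ j₂' c35 p (wQ8P d mm ι a e hd hL hL7 ha hc35 he μ₁ μ₂ hP hD α β j j' α' β' j₂ j₂' p))) ∧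
      N15At (ne2OfRecord₁₁ (sfObjects₈qvr d mm ι a e hL μ₁ μ₂ α β j j' α' β' j₂ j₂' c35 p (wQ8P d mm ι a e hd hL hL7 ha hc35 he μ₁ μ₂ hP hD α β j j' α' β' j₂ j₂' p))) :=
  Classical.choose_spec (exists_live_and_n15At_sfObjects₈qvr_of_gradDiffRow d mm ι a e hd hL hL7 ha hc35 he μ₁ μ₂ hP hD α β j j' α' β' j₂ j₂' p)

/-- ★★ **THE (P-R) FOUR-ENTRIES LITERAL AT ANY KEYED HOME** (part 30's interface; `ne2At` a BINDER, `hadm` AND the value equation `h` hypotheses — no pin, no v8): a rate home over ANY key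
admitting only the literals of a key-indexed NE2 reading whose value everywhere is the pinned (P-R) one-propagator literal has `S_N15 RRec` — modulo `hG` (thresholded) ONLY. [bookkeeping] -/
theorem s_N15_of_admits_sf₈qvr_gradDiff [Nonempty ι] (hd : 1 ≤ d) (hL : Odd L ∧ 1 < L) (hL7 : 7 ≤ L) (ha : 0 < a) {c35 : ℝ} (hc35 : 0 < c35)
    (he : ∀ A B : Matrix mm mm ℂ, traceForm A B = e A ⬝ᵥ e B) (μ₁ μ₂ : Fin (d + 1))
    (hP : ∃ δ₂ P0 aP : ℝ, 0 < δ₂ ∧ 0 ≤ P0 ∧ 0 < aP ∧ ∀ i : SfIdx d L,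
        ∀ α₀ : ℝ, 0 < α₀ → (L : ℝ) ^ i.m * α₀ ≤ aP → ∀ A' : Fin (d + 1) → CvX' d L i.m i.kk i.r hL → Matrix mm mm ℂ, (sfInstance d mm ι hL i).Bf.Reg335 c35 α₀ A' →
          HasMaj (BlockNorm.ofBlocks (unitTorusGeo L i.kk (cvM d L i.m i.kk hL)) (liftBlk (blockOf (L ^ i.kk) (cvM d L i.m i.kk hL)) ι)) (BlockNorm.ofBlocks (unitTorusGeo L i.kk (cvM d L i.m i.kk hL)) (liftBlk (fun b : Tor (fine (L ^ i.kk) (cvM d L i.m i.kk hL)) × Fin (d + 1) => blockOf (L ^ i.kk) (cvM d L i.m i.kk hL) b.1) ι)) (Matrix.mulVecLin (cgrad (cvM d L i.m i.kk hL) (L ^ i.kk) (cvT₀ e (fun μ x => NormedSpace.exp (((((L ^ i.kk : ℕ) : ℝ))⁻¹) • gavgM (Matrix mm mm ℂ) (Fin (d + 1)) (kingPrV L i.kk i.r (cvM d L i.m i.kk hL)) A' μ x))) * cGreen (cvM d L i.m i.kk hL) (L ^ i.kk) (cvT₀ e (fun μ x => NormedSpace.exp (((((L ^ i.kk : ℕ)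 : ℝ))⁻¹) • gavgM (Matrix mm mm ℂ) (Fin (d + 1)) (kingPrV L i.kk i.r (cvM d L i.m i.kk hL)) A' μ x))) (aK 1 (L : ℝ) i.kk * ((L ^ i.kk : ℕ) : ℝ) ^ (d + 1)) - cgrad (cvM d L i.m i.kk hL) (L ^ i.kk) (fun (_ : Fin (d + 1)) (_ : Tor (fine (L ^ i.kk) (cvM d L i.m i.kk hL))) => (1 : Matrix ι ι ℝ)) * cGreen (cvM d L i.m i.kk hL) (L ^ i.kk) (fun (_ : Fin (d + 1)) (_ : Tor (fine (L ^ i.kk) (cvM d L i.m i.kk hL))) => (1 : Matrix ι ι ℝ)) (aK 1 (L : ℝ) i.kk * ((L ^ i.kk : ℕ) : ℝ) ^ (d + 1)))) (fun y y' => P0 * (c35 * (L : ℝ) ^ i.m * α₀) * Real.exp (-(δ₂ * (unitTorusGeo L i.kk (cvM d L i.m i.kk hL)).dist y y'))) ∧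
          HasMaj (BlockNorm.ofBlocks (unitTorusGeo L i.kk (cvM d L i.m i.kk hL)) (liftBlk (blockOf (L ^ i.r * L ^ i.kk) (cvM d L i.m i.kk hL)) ι)) (BlockNorm.ofBlocks (unitTorusGeo L i.kk (cvM d L i.m i.kk hL)) (liftBlk (fun b : Tor (fine (L ^ i.r * L ^ i.kk) (cvM d L i.m i.kk hL)) × Fin (d + 1) => blockOf (L ^ i.r * L ^ i.kk) (cvM d L i.m i.kk hL) b.1) ι)) (Matrix.mulVecLin (cgrad (cvM d L i.m i.kk hL) (L ^ i.r * L ^ i.kk) (cvT₀ e (fun μ x' => NormedSpace.exp (((((L ^ i.r * L ^ i.kk : ℕ) : ℝ))⁻¹) • A' μ x'))) * cGreen (cvM d L i.m i.kk hL) (L ^ i.r * L ^ i.kk) (cvT₀ e (fun μ x' => NormedSpace.exp (((((L ^ i.r * L ^ i.kk : ℕ) : ℝ))⁻¹) • A' μ x'))) (aK 1 (L : ℝ) (i.r + i.kk) * ((L ^ i.r * L ^ i.kk : ℕ) : ℝ) ^ (d + 1)) - cgrad (cvM d L i.m i.kk hL) (L ^ i.r * L ^ i.kk) (fun (_ : Fin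 (d + 1)) (_ : Tor (fine (L ^ i.r * L ^ i.kk) (cvM d L i.m i.kk hL))) => (1 : Matrix ι ι ℝ)) * cGreen (cvM d L i.m i.kk hL) (L ^ i.r * L ^ i.kk) (fun (_ : Fin (d + 1)) (_ : Tor (fine (L ^ i.r * L ^ i.kk) (cvM d L i.m i.kk hL))) => (1 : Matrix ι ι ℝ)) (aK 1 (L : ℝ) (i.r + i.kk) * ((L ^ i.r * L ^ i.kk : ℕ) : ℝ) ^ (d + 1)))) (fun y y' => P0 * (c35 * (L : ℝ) ^ i.m * α₀) * Real.exp (-(δ₂ * (unitTorusGeo L i.kk (cvM d L i.m i.kk hL)).dist y y'))))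
    (hD : ∃ δD CR γR aD : ℝ, 0 < δD ∧ 0 ≤ CR ∧ 0 < γR ∧ 0 < aD ∧
      ∀ i : SfIdx d L, ∀ α₀ : ℝ, 0 < α₀ → (L : ℝ) ^ i.m * α₀ ≤ aD → ∀ A' : Fin (d + 1) → CvX' d L i.m i.kk i.r hL → Matrix mm mm ℂ, (sfInstance d mm ι hL i).Bf.Reg335 c35 α₀ A' →
        HasMaj (CvNorm d L i.m i.kk hL ι) (BlockNorm.ofBlocks (unitTorusGeo L i.kk (cvM d L i.m i.kk hL)) (liftBlk (cvBlk d L i.m i.kk hL ∘ (kingPrV L i.kk i.r (cvM d L i.m i.kk hL))) ι)) (idef (pull (liftMap (kingPrV L i.kk i.r (cvM d L i.m i.kk hL)) ι)) (pull (liftMap (kingPrV L i.kk i.r (cvM d L i.m i.kk hL)) ι)) (cvNVr' d L i.m i.kk i.r hL a ι e (fun μ x' => NormedSpace.exp (((((L ^ i.r * L ^ i.kk : ℕ) : ℝ))⁻¹) • A' μ x'))) (cvNVr d L i.m i.kk hL a ι e (fun μ x => NormedSpace.exp (((((L ^ i.kk : ℕ) : ℝ))⁻¹) • gavgM (Matrix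 mm mm ℂ) (Fin (d + 1)) (kingPrV L i.kk i.r (cvM d L i.m i.kk hL)) A' μ x)))) (fun y y' => (CR * ((L : ℝ) ^ i.kk) ^ (-γR)) * Real.exp (-(δD * (unitTorusGeo L i.kk (cvM d L i.m i.kk hL)).dist y y'))))
    (α β : Fin (d + 1)) (j j' : ι) (α' β' : Fin (d + 1)) (j₂ j₂' : ι) (p : ℝ)
    (ne2At : ∀ {F : T4Family} {D : Datum F N}, key F D → (ℕ → ℝ) → List (ULoop F) → ℕ → NE2Objects₁₁) (RRec : RateRecordPred N)
    (hadm : ∀ (F : T4Family) (D : Datum F N) (g₀ : ℕ → ℝ) (os : List (ULoop F)) (R : RateCarriers N), RRec F D g₀ os R →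
      ∃ (h : key F D) (k : ℕ), R.ne2 = ne2OfRecord₁₁ (ne2At h g₀ os k))
    (h : ∀ (F : T4Family) (D : Datum F N) (h : key F D) (g₀ : ℕ → ℝ) (os : List (ULoop F)) (k : ℕ),
      ne2At h g₀ os k = sfObjects₈qvr d mm ι a e hL μ₁ μ₂ α β j j' α' β' j₂ j₂' c35 p (wQ8P d mm ι a e hd hL hL7 ha hc35 he μ₁ μ₂ hP hD α β j j' α' β' j₂ j₂' p)) :
    S_N15 RRec :=
  s_N15_of_admits ne2At RRec hadm fun F D hk g₀ os k => by
    rw [h F D hk g₀ os k]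
    exact (live_and_n15At_sfObjects₈qvr_wQ8P d mm ι a e hd hL hL7 ha hc35 he μ₁ μ₂ hP hD α β j j' α' β' j₂ j₂' p).2

end Closed

end Summit.QuantumFields.YangMills.BalabanUVNodes.N15.SiteLayerSf

end
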